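import Literature.AlgebraicGeometry.Resolution.KummerCone
import Mathlib.FieldTheory.KummerPolynomial
import Mathlib.RingTheory.IntegralClosure.IntegrallyClosed
import Mathlib.RingTheory.Localization.FractionRing
import Mathlib.Algebra.CharP.Lemmas
import Mathlib.Algebra.CharP.Algebra
import HarnessLib

/-!
# The Kummer chart on the sections of the normalised cover, and the model is a domain

Topic: `Literature/AlgebraicGeometry/Resolution`. Two Γ-level constructions for the local
log-regular charts of the normalised `p`-cyclic cover `t^p = a` along an snc boundary
(K. Kato, *Toric singularities*, Amer. J. Math. 116 (1994), (2.2)(2); J. Giraud, Bull. SMF 111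
(1983), Prop. 1.5):

* `exists_kummerChart` — let `A → B` be an extension of domains of characteristic `p` with
  `B` integrally closed, `t ∈ B` with `t^p = a`, and the radicand in twisted Kummer form
  `a - g^p = u₁^p ∏ x_j^{A_j}` in `A` (`u₁` a unit, `x_j ≠ 0`, `c₀ A_{j₀} ≡ 1 (mod p)`,
  `c_j = c₀ A_j mod p`). Then there is a monoid homomorphism
  `Φ : kummerCone p j₀ c → (B, ·)` with `Φ(v)^p = ∏ x_j^{e_j(v)}`, `e = kummerExp v` the
  honest exponent: in `Frac B` the element `τ = ((t - g)/u₁)^{c₀} / x^{⌊c₀ A/p⌋}` has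
  `τ^p = x^c`, the Laurent monomials `τ^{v_{j₀}} ∏_{j ≠ j₀} x_j^{v_j}` have `p`-th powers
  `x^{e(v)} ∈ A` for `v` in the cone, hence are integral and lie in `B`;
* `isDomain_adjoinRoot_of_forall_pow_ne` — if `a` is not a `p`-th power in the fraction field
  of the domain `S`, then `S[T]/(T^p - a)` is a domain (`T^p - a` is irreducible over
  `Frac S`, and `S[T]/(T^p - a) ↪ Frac(S)[T]/(T^p - a)` because `T^p - a` is monic).

Sources: [Kato1994] K. Kato, Amer. J. Math. 116 (1994), (2.2)(2). [Giraud1983] J. Giraud,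
Bull. SMF 111 (1983), Prop. 1.5.
-/

noncomputable section

namespace Literature.AlgebraicGeometry.Resolution

open Polynomial

/-! ## The model `S[T]/(T^p - a)` is a domain -/

/-- **`S[T]/(T^p - a)` is a domain** when `a` is not a `p`-th power in the fraction field `K`
of the domain `S` (`p` prime): `T^p - a` is irreducible over `K`, so `K[T]/(T^p - a)` is a
field, and `S[T]/(T^p - a) → K[T]/(T^p - a)` is injective since divisibility by the monic
`T^p - a` can be tested over `K`. [folklore] -/
theorem isDomain_adjoinRoot_of_forall_pow_ne {S K : Type*} [CommRing S] [IsDomain S] [Field K]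
    [Algebra S K] [IsFractionRing S K] {p : ℕ} (hp : p.Prime) {a : S}
    (ha : ∀ c : K, c ^ p ≠ algebraMap S K a) :
    IsDomain (AdjoinRoot ((X : S[X]) ^ p - C a)) := by
  set f : S[X] := X ^ p - C a with hf
  have hfK : f.map (algebraMap S K) = X ^ p - C (algebraMap S K a) := by
    rw [hf, Polynomial.map_sub, Polynomial.map_pow, map_X, map_C]
  have hirr : Irreducible (f.map (algebraMap S K)) := by
    rw [hfK]; exact X_pow_sub_C_irreducible_of_prime hp ha
  haveI : Fact (Irreducible (f.map (algebraMap S K))) := ⟨hirr⟩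
  have hmonic : f.Monic := monic_X_pow_sub_C a hp.ne_zero
  -- the map `S[T]/(f) → K[T]/(f)`
  let φ : AdjoinRoot f →+* AdjoinRoot (f.map (algebraMap S K)) :=
    AdjoinRoot.lift ((AdjoinRoot.of _).comp (algebraMap S K)) (AdjoinRoot.root _) (by
      rw [← eval₂_map, ← AdjoinRoot.algebraMap_eq, ← aeval_def, AdjoinRoot.aeval_eq,
        AdjoinRoot.mk_self])
  have hφ : Function.Injective φ := by
    rw [injective_iff_map_eq_zero]
    intro z hz
    obtain ⟨g, rfl⟩ := AdjoinRoot.mk_surjective z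
    have h1 : φ (AdjoinRoot.mk f g) = AdjoinRoot.mk (f.map (algebraMap S K)) (g.map (algebraMap S K)) := by
      rw [AdjoinRoot.lift_mk, ← eval₂_map, ← AdjoinRoot.algebraMap_eq, ← aeval_def,
        AdjoinRoot.aeval_eq]
    rw [h1, AdjoinRoot.mk_eq_zero, Polynomial.map_dvd_map _ (IsFractionRing.injective S K) hmonic]
      at hz
    exact AdjoinRoot.mk_eq_zero.mpr hz
  exact Function.Injective.isDomain φ hφ

/-! ## The Kummer chart on the sections of the normalised cover -/

section Chart

variable {A B : Type*} [CommRing A] [IsDomain A] [CommRing B] [IsDomain B] [IsIntegrallyClosed B]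
  [Algebra A B] {r : ℕ}

omit [IsDomain A] [IsDomain B] in
/-- Lifting a `K`-valued monoid homomorphism with integral values into the integrally closed
`B`: if every value has its `p`-th power in `B`, the homomorphism factors through `B`.
[folklore] -/
theorem exists_monoidHom_of_pow_mem {K : Type*} [Field K] [Algebra B K] [IsFractionRing B K]
    {M : Type*} [Monoid M] (Ψ : M →* K) {p : ℕ} (hp : p ≠ 0)
    (h : ∀ m, ∃ b : B, algebraMap B K b = Ψ m ^ p) :
    ∃ Φ : M →* B, ∀ m, algebraMap B K (Φ m) = Ψ m := by
  have hint : ∀ m, ∃ b : B, algebraMap B K b = Ψ m := by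
    intro m
    obtain ⟨b, hb⟩ := h m
    refine IsIntegrallyClosed.algebraMap_eq_of_integral ⟨X ^ p - C b, monic_X_pow_sub_C b hp, ?_⟩
    rw [eval₂_sub, eval₂_X_pow, eval₂_C, hb, sub_self]
  choose Φ hΦ using hint
  have hinj := IsFractionRing.injective B K
  refine ⟨{ toFun := Φ, map_one' := hinj ?_, map_mul' := fun m m' => hinj ?_ }, hΦ⟩
  · rw [hΦ, map_one, map_one]
  · rw [hΦ, map_mul, map_mul, hΦ, hΦ]

/-- **The Kummer chart on the sections of the normalised cover.** See the module docstring.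
[cite: Kato1994, (2.2)(2)] -/
theorem exists_kummerChart (p : ℕ) [hp : Fact p.Prime] [CharP B p]
    (hinj : Function.Injective (algebraMap A B)) (x : Fin r → A) (hx : ∀ j, x j ≠ 0)
    (A' : Fin r → ℕ) (j₀ : Fin r) (c₀ : ℕ) (hc₀ : c₀ * A' j₀ % p = 1) (a g u₁ : A) (hu₁ : IsUnit u₁)
    (ha : a - g ^ p = u₁ ^ p * ∏ j, x j ^ A' j) (t : B) (ht : t ^ p = algebraMap A B a) :
    ∃ Φ : Multiplicative (kummerCone p j₀ (fun j => c₀ * A' j % p)) →* B,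
      ∀ v : kummerCone p j₀ (fun j => c₀ * A' j % p), Φ (Multiplicative.ofAdd v) ^ p =
        algebraMap A B (∏ j, x j ^ (kummerExp p j₀ (fun j => c₀ * A' j % p) v j).toNat) := by
  classical
  have hp' : p.Prime := hp.out
  set c : Fin r → ℕ := fun j => c₀ * A' j % p with hcdef
  let K := FractionRing B
  have hinjK : Function.Injective (algebraMap A K) := by
    rw [IsScalarTower.algebraMap_eq A B K, RingHom.coe_comp]
    exact (IsFractionRing.injective B K).comp hinj
  haveI : CharP K p := charP_of_injective_algebraMap (IsFractionRing.injective B K) p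
  have hxK : ∀ j, algebraMap A K (x j) ≠ 0 := fun j => (map_ne_zero_iff _ hinjK).mpr (hx j)
  have hu₁K : algebraMap A K u₁ ≠ 0 := (map_ne_zero_iff _ hinjK).mpr hu₁.ne_zero
  have hprodK : ∀ e : Fin r → ℕ, algebraMap A K (∏ j, x j ^ e j) ≠ 0 := fun e =>
    (map_ne_zero_iff _ hinjK).mpr (Finset.prod_ne_zero_iff.mpr fun j _ => pow_ne_zero _ (hx j))
  -- `ω = t - g`, `ω^p = u₁^p x^A`
  set ω : K := algebraMap B K t - algebraMap A K g with hω
  have hωp : ω ^ p = algebraMap A K (u₁ ^ p * ∏ j, x j ^ A' j) := by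
    rw [hω, sub_pow_char, ← map_pow, ht, ← IsScalarTower.algebraMap_apply, ← map_pow, ← map_sub, ha]
  -- `τ`, `τ^p = x^c`
  set τ : K := (ω / algebraMap A K u₁) ^ c₀ / algebraMap A K (∏ j, x j ^ (c₀ * A' j / p)) with hτdef
  have hτ : τ ^ p = algebraMap A K (∏ j, x j ^ c j) := by
    rw [hτdef, div_pow, ← pow_mul, mul_comm c₀ p, pow_mul, div_pow, hωp, map_mul, map_pow,
      mul_div_cancel_left₀ _ (pow_ne_zero _ hu₁K), div_eq_iff (pow_ne_zero _ (hprodK _)),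
      ← map_pow, ← map_pow, ← map_mul]
    congr 1
    rw [← Finset.prod_pow, ← Finset.prod_pow, ← Finset.prod_mul_distrib]
    refine Finset.prod_congr rfl fun j _ => ?_
    rw [← pow_mul, ← pow_mul, ← pow_add]
    congr 1
    rw [hcdef]
    simp only
    rw [mul_comm (A' j) c₀, Nat.mod_add_div']
  have hτ0 : τ ≠ 0 := fun h0 => by
    have := hτ; rw [h0, zero_pow hp'.ne_zero] at this; exact hprodK _ this.symm
  -- the `K`-valued chart on all of `ℤʳ`
  let Ψ : Multiplicative (kummerCone p j₀ c) →* K :=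
    { toFun := fun v => τ ^ (((Multiplicative.toAdd v : kummerCone p j₀ c) : Fin r → ℤ) j₀) *
        ∏ j ∈ Finset.univ.erase j₀,
          algebraMap A K (x j) ^ (((Multiplicative.toAdd v : kummerCone p j₀ c) : Fin r → ℤ) j)
      map_one' := by simp
      map_mul' := fun v w => by
        simp only [toAdd_mul, AddSubmonoid.coe_add, Pi.add_apply, zpow_add₀ hτ0,
          zpow_add₀ (hxK _), Finset.prod_mul_distrib]
        ring }
  -- `p`-th powers of the Laurent monomials, for every exponent vector
  have hpow : ∀ v : Fin r → ℤ, (τ ^ (v j₀) * ∏ j ∈ Finset.univ.erase j₀, algebraMap A K (x j) ^ (v j)) ^ p =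
      ∏ j, algebraMap A K (x j) ^ (kummerExp p j₀ c v j) := by
    intro v
    have h1 : (τ ^ (v j₀)) ^ p = ∏ j, algebraMap A K (x j) ^ ((c j : ℤ) * v j₀) := by
      rw [← zpow_natCast (τ ^ v j₀) p, ← zpow_mul, mul_comm, zpow_mul, zpow_natCast, hτ,
        map_prod, ← Finset.prod_zpow]
      refine Finset.prod_congr rfl fun j _ => ?_
      rw [map_pow, ← zpow_natCast, ← zpow_mul]
    have h2 : (∏ j ∈ Finset.univ.erase j₀, algebraMap A K (x j) ^ (v j)) ^ p =
        ∏ j ∈ Finset.univ.erase j₀, algebraMap A K (x j) ^ ((p : ℤ) * v j) := by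
      rw [← Finset.prod_pow]
      refine Finset.prod_congr rfl fun j _ => ?_
      rw [← zpow_natCast, ← zpow_mul, mul_comm]
    rw [mul_pow, h1, h2, ← Finset.mul_prod_erase _ _ (Finset.mem_univ j₀),
      ← Finset.mul_prod_erase _ (fun j => algebraMap A K (x j) ^ kummerExp p j₀ c v j)
        (Finset.mem_univ j₀), mul_assoc, ← Finset.prod_mul_distrib]
    have hcj₀ : (c j₀ : ℤ) = 1 := by rw [hcdef]; simp only; rw [hc₀]; rfl
    congr 1
    · rw [kummerExp_apply_self, hcj₀, one_mul]
    · refine Finset.prod_congr rfl fun j hj => ?_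
      rw [kummerExp_apply_of_ne p c v (Finset.ne_of_mem_erase hj), zpow_add₀ (hxK j)]
  have hΨp : ∀ v : kummerCone p j₀ c, ∃ b : B, algebraMap B K b = Ψ (Multiplicative.ofAdd v) ^ p := by
    intro v
    refine ⟨algebraMap A B (∏ j, x j ^ (kummerExp p j₀ c v j).toNat), ?_⟩
    rw [← IsScalarTower.algebraMap_apply, map_prod]
    change _ = (τ ^ ((v : Fin r → ℤ) j₀) *
      ∏ j ∈ Finset.univ.erase j₀, algebraMap A K (x j) ^ ((v : Fin r → ℤ) j)) ^ p
    rw [hpow]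
    refine Finset.prod_congr rfl fun j _ => ?_
    rw [map_pow, ← zpow_natCast, Int.toNat_of_nonneg (v.2 j)]
  obtain ⟨Φ, hΦ⟩ := exists_monoidHom_of_pow_mem Ψ hp'.ne_zero hΨp
  refine ⟨Φ, fun v => (IsFractionRing.injective B K) ?_⟩
  obtain ⟨b, hb⟩ := hΨp v
  rw [map_pow, hΦ, ← hb]
  -- `b` is the stated product (by construction of `hΨp`)
  rw [hb]
  change Ψ (Multiplicative.ofAdd v) ^ p = algebraMap B K (algebraMap A B _)
  rw [← IsScalarTower.algebraMap_apply, map_prod]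
  change (τ ^ ((v : Fin r → ℤ) j₀) *
    ∏ j ∈ Finset.univ.erase j₀, algebraMap A K (x j) ^ ((v : Fin r → ℤ) j)) ^ p = _
  rw [hpow]
  refine Finset.prod_congr rfl fun j _ => ?_
  rw [map_pow, ← zpow_natCast, Int.toNat_of_nonneg (v.2 j)]

end Chart

end Literature.AlgebraicGeometry.Resolution

end
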